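import Summits.CriticalPhenomena.PercolationContinuityZ3.Theorems.Transplant.FKConnectivityAllQAntipodalAndGenSeries
import Summits.CriticalPhenomena.PercolationContinuityZ3.Theorems.Transplant.FKConnectivityAllQAntipodalAndGenParallel
import Summits.CriticalPhenomena.PercolationContinuityZ3.Theorems.Transplant.FKConnectivityAllQAntipodalAndGenSides
import HarnessLib

/-!
# Connectivity correlation inequalities for `φ_{w,q}`, every `q > 0` — file 32c: **CONJECTURE `C_∞` FOR THE AND TYPE, ALL LEVELS, ON EVERY
# 2-CONNECTED SERIES–PARALLEL GRAPH** — every coefficient of `Z_H² · Cov_{φ_{z,q}}(∏_{e ∈ S} ω_e, g)` is `≤ 0` (`0 < q ≤ 1`, `g` increasing)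

Support file (`--supports stmt-CriticalPhenomena-4575`), FK sub-lane `prim-bschramm-fk-2` (gen 19) of the post-continuity programme; builds
on p205010 (kernel theorem, internal audit signed; external expert review pending).  No definitions, no named facts, no sorries; standard axioms.

THE RESULT (gen 10's Conjecture `C_∞`, FK-Q2 §20, for the AND type — the conjecture that organised gens 11–19 of this sub-lane).  Let `E` be a
two-terminal series–parallel network between `s` and `t` not containing the edge `st` (so `H = E ∪ {st}` is an ARBITRARY 2-connected
series–parallel graph presented from ANY of its edges, Duffin), and let `N` (free), `T` (the other AND edges) and `C` (contracted) be pairwise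
disjoint subsets of `E`; `S = T ∪ {st}`.  Then for every `0 < q ≤ 1` and every increasing `g` not reading `S`:
* **`FK.apPsiC_and_nonpos_of_isTTSP`**: `apPsiC q (N ∪ S) C 1_{S ⊆ ·} g ≤ 0` — the coefficient of `z^{1_{N ∪ S} + 2·1_C}` (other edges deleted)
  in `Z_H(z)² Cov_{φ_{z,q}}(∏_{e∈S} ω_e, g)` is `≤ 0`: EVERY coefficient, for EVERY edge set `S` of `H` (gen 11's `apPsiC_edge_nonpos_of_isTTSP`
  is `|S| = 1`; files 30a/31b are `|S| = 3`);
* **`FK.apPsi_and_nonpos_of_isTTSP`**: the square-free case `C = ∅` in gen 10's `apPsi` form.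
In particular `Cov_{φ_{p,q}}(∏_{e∈S} ω_e, g) ≤ 0` coefficientwise in the edge odds — the strongest form of negative dependence between an AND
event and an increasing function on series–parallel graphs at `q ≤ 1` (false on `K₄` already for `|S| = 1`).
PROOF (`andGen_drift_nonpos_of_isTTSP`, strong induction on `|E|`): the GENERAL AND-DRIFT
`D = ∑_{γ ⊆ N} (q^{k(γ∪A∪st)+k((N\γ)∪C)} - q^{k((N\γ)∪A∪st)+k(γ∪C)}) h(γ)` (`A = T ∪ C`) is `≤ 0`.  SERIES root `E₁(s,m)·E₂(m,t)`: file 32's identity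
reduces `D` to the drifts of the sides with the VIRTUAL roots `sm`, `mt` and the ROOTLESS drifts of the sides; PARALLEL root: file 32a's
identity reduces `D` to the drifts of the sides with the same root and the rootless drifts with `st` attached and contracted.  A rootless drift
is either identically `0` (`A = C`) or becomes rooted at any `e ∈ A \ C` inside the ambient network `(E ∪ {root}) \ e` (Duffin re-rooting,
`IsTTSP.reroot_erase`); a virtual root that is already an edge of the side is attached (⇒ rootless), deleted (⇒ erase it from the ambient
network, `IsTTSP.erase_terminal_edge`), or free (⇒ the doubled-root decomposition `andGen_doubled`).  Every recursive call has a strictly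
smaller ambient network.  No case analysis of SP trees, no LP certificates at run time: the two junction identities were found by linear
programming over junction types (kit j153750/j153907/j156070) and are sixteen-case `ring` lemmas.
[cite: Grimmett2006, §1.4 eq. (1.20) (p. 15); §3.8 Thm. (3.90) (pp. 61–62); §3.9 (pp. 63–64)] [cite: Wagner2006, Thm. 5.8(d), §5.3]
-/

noncomputable section

namespace Summit.CriticalPhenomena.PercolationContinuityZ3.Theorems

namespace FK

open SimpleGraph Literature.Probability.LatticeModels Literature.Probability.Percolation
open scoped Classical

variable {V : Type*} [Fintype V]

section GenPath

/-- **THE MASTER INDUCTION (general AND-drift).**  For every two-terminal series–parallel `E` between `s, t` with `st ∉ E`, every free set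
`N ⊆ E`, attached set `A ⊆ E` disjoint from `N`, contracted set `C ⊆ A`, every `h` monotone on the subsets of `N` and `0 < q ≤ 1`:
`∑_{γ ⊆ N} (q^{k(γ ∪ A ∪ st) + k((N\γ) ∪ C)} - q^{k((N\γ) ∪ A ∪ st) + k(γ ∪ C)}) h(γ) ≤ 0` — strong induction on `|E|` (the bound `n`); inside
the step: the ROOTLESS drift and the drift with a VIRTUAL root of any network of size `≤ n` (by re-rooting / erasing / the doubled-root
decomposition), then the series and parallel junction theorems `andGen_series_nonpos`, `andGen_parallel_nonpos`.
[cite: Grimmett2006, §3.8 Thm. (3.90) (pp. 61–62); §3.9 (pp. 63–64)] [cite: Wagner2006, Thm. 5.8(d), §5.3] -/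
theorem andGen_drift_nonpos_of_isTTSP {q : ℝ} (hq0 : 0 < q) (hq1 : q ≤ 1) :
    ∀ (n : ℕ) {E : Finset (Sym2 V)} {s t : V} {N A C : Finset (Sym2 V)}, E.card ≤ n → IsTTSP E s t → s(s, t) ∉ E →
      N ⊆ E → A ⊆ E → C ⊆ A → Disjoint N A →
      ∀ h : Finset (Sym2 V) → ℝ, (∀ ⦃X Y : Finset (Sym2 V)⦄, X ⊆ Y → Y ⊆ N → h X ≤ h Y) →
        ∑ γ ∈ N.powerset,
          (q ^ (clusterCount (↑(insert s(s, t) (γ ∪ A)) : BondConfig V) ∅ + clusterCount (↑(N \ γ ∪ C) : BondConfig V) ∅) -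
            q ^ (clusterCount (↑(insert s(s, t) (N \ γ ∪ A)) : BondConfig V) ∅ + clusterCount (↑(γ ∪ C) : BondConfig V) ∅)) * h γ ≤ 0 := by
  intro n
  induction n with
  | zero =>
    intro E s t N A C hcard hE _ _ _ _ _ _ _
    rw [Nat.le_zero, Finset.card_eq_zero] at hcard
    obtain ⟨e, he, _⟩ := hE.left_mem
    rw [hcard] at he
    exact absurd he (Finset.notMem_empty _)
  | succ n ih =>
    -- (R) the ROOTLESS drift of a network of size `≤ n`
    have rootless : ∀ {F : Finset (Sym2 V)} {u v : V} {N A C : Finset (Sym2 V)}, F.card ≤ n → IsTTSP F u v →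
        N ⊆ F → A ⊆ insert s(u, v) F → C ⊆ A → Disjoint N A →
        ∀ h : Finset (Sym2 V) → ℝ, (∀ ⦃X Y : Finset (Sym2 V)⦄, X ⊆ Y → Y ⊆ N → h X ≤ h Y) →
          ∑ γ ∈ N.powerset,
            (q ^ (clusterCount (↑(γ ∪ A) : BondConfig V) ∅ + clusterCount (↑(N \ γ ∪ C) : BondConfig V) ∅) -
              q ^ (clusterCount (↑(N \ γ ∪ A) : BondConfig V) ∅ + clusterCount (↑(γ ∪ C) : BondConfig V) ∅)) * h γ ≤ 0 := by
      intro F u v N A C hF hFT hN hA hCA hNA h hm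
      by_cases hAC : A = C
      · subst hAC; exact (andGen_rootless_self q N A h).le
      · obtain ⟨e, he⟩ : (A \ C).Nonempty := by
          rw [Finset.nonempty_iff_ne_empty, Ne, Finset.sdiff_eq_empty_iff_subset]
          exact fun hh => hAC (le_antisymm hh hCA)
        revert he
        refine Sym2.ind (fun x y => ?_) e
        intro he
        have hxA : s(x, y) ∈ A := (Finset.mem_sdiff.1 he).1
        have hxC : s(x, y) ∉ C := (Finset.mem_sdiff.1 he).2
        by_cases hN0 : N = ∅
        · subst hN0; exact (andGen_rootless_sum_empty q A C h).le
        · have hxF : s(x, y) ∈ insert s(u, v) F := hA hxA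
          have hne : insert s(u, v) F ≠ {s(x, y)} := by
            intro hh
            obtain ⟨f, hf⟩ := Finset.nonempty_iff_ne_empty.2 hN0
            have hf' : f ∈ ({s(x, y)} : Finset (Sym2 V)) := hh ▸ Finset.mem_insert_of_mem (hN hf)
            rw [Finset.mem_singleton] at hf'
            exact Finset.disjoint_left.1 hNA hf (hf' ▸ hxA)
          have hE' : IsTTSP ((insert s(u, v) F).erase s(x, y)) x y := hFT.reroot_erase hxF hne
          have hcard' : ((insert s(u, v) F).erase s(x, y)).card ≤ n := by
            have h1 := Finset.card_erase_of_mem hxF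
            have h2 := Finset.card_insert_le s(u, v) F
            have h3 := Finset.card_pos.2 ⟨s(x, y), hxF⟩
            omega
          have key := ih hcard' hE' (Finset.notMem_erase _ _) (N := N) (A := A.erase s(x, y)) (C := C)
            (fun f hf => Finset.mem_erase.2 ⟨fun hh => Finset.disjoint_left.1 hNA hf (hh ▸ hxA), Finset.mem_insert_of_mem (hN hf)⟩)
            (fun f hf => Finset.mem_erase.2 ⟨(Finset.mem_erase.1 hf).1, hA (Finset.mem_of_mem_erase hf)⟩)
            (fun f hf => Finset.mem_erase.2 ⟨fun hh => hxC (hh ▸ hf), hCA hf⟩)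
            (Finset.disjoint_of_subset_right (Finset.erase_subset _ _) hNA) h hm
          have hins : ∀ X : Finset (Sym2 V), insert s(x, y) (X ∪ A.erase s(x, y)) = X ∪ A := fun X => by
            rw [← Finset.union_insert, Finset.insert_erase hxA]
          simp_rw [hins] at key
          exact key
    -- (V) the drift with a VIRTUAL root `uv` (possibly an edge of the network) of a network of size `≤ n`
    have virt : ∀ {F : Finset (Sym2 V)} {u v : V} {N A C : Finset (Sym2 V)}, F.card ≤ n → IsTTSP F u v →
        N ⊆ F → A ⊆ F → C ⊆ A → Disjoint N A →
        ∀ h : Finset (Sym2 V) → ℝ, (∀ ⦃X Y : Finset (Sym2 V)⦄, X ⊆ Y → Y ⊆ N → h X ≤ h Y) →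
          ∑ γ ∈ N.powerset,
            (q ^ (clusterCount (↑(insert s(u, v) (γ ∪ A)) : BondConfig V) ∅ + clusterCount (↑(N \ γ ∪ C) : BondConfig V) ∅) -
              q ^ (clusterCount (↑(insert s(u, v) (N \ γ ∪ A)) : BondConfig V) ∅ + clusterCount (↑(γ ∪ C) : BondConfig V) ∅)) *
              h γ ≤ 0 := by
      intro F u v N A C hF hFT hN hA hCA hNA h hm
      by_cases huvF : s(u, v) ∈ F
      swap
      · exact ih hF hFT huvF hN hA hCA hNA h hm
      by_cases huvA : s(u, v) ∈ A
      · -- the root is attached: rootless drift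
        have hins : ∀ X : Finset (Sym2 V), insert s(u, v) (X ∪ A) = X ∪ A := fun X =>
          Finset.insert_eq_of_mem (Finset.mem_union_right _ huvA)
        simp_rw [hins]
        exact rootless hF hFT hN (hA.trans (Finset.subset_insert _ _)) hCA hNA h hm
      by_cases huvN : s(u, v) ∈ N
      · -- the root is free: the doubled-root decomposition
        by_cases hF1 : F = {s(u, v)}
        · have hN' : N.erase s(u, v) = ∅ := Finset.eq_empty_of_forall_notMem fun f hf => by
            have hfF := hN (Finset.mem_of_mem_erase hf)
            rw [hF1, Finset.mem_singleton] at hfF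
            exact (Finset.mem_erase.1 hf).1 hfF
          refine andGen_doubled hq0 hq1 huvN ?_ ?_ hm
          · intro h' _
            rw [hN']
            exact (andGen_sum_empty q A C _ h').le
          · intro h' _
            rw [hN', Finset.powerset_empty, Finset.sum_singleton, Finset.empty_sdiff, Finset.empty_union, Finset.empty_union,
              sub_self, zero_mul]
        · have hE' : IsTTSP (F.erase s(u, v)) u v := hFT.erase_terminal_edge huvF hF1
          have hcard' : (F.erase s(u, v)).card ≤ n := (Finset.card_erase_le).trans hF
          refine andGen_doubled hq0 hq1 huvN ?_ ?_ hm
          · intro h' hm'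
            exact ih hcard' hE' (Finset.notMem_erase _ _) (Finset.erase_subset_erase _ hN)
              (fun f hf => Finset.mem_erase.2 ⟨fun hh => huvA (hh ▸ hf), hA hf⟩) hCA
              (Finset.disjoint_of_subset_left (Finset.erase_subset _ _) hNA) h' hm'
          · intro h' hm'
            have key := rootless hF hFT ((Finset.erase_subset _ _).trans hN) (A := insert s(u, v) A) (C := insert s(u, v) C)
              (Finset.insert_subset_insert _ hA) (Finset.insert_subset_insert _ hCA)
              (Finset.disjoint_insert_right.2 ⟨Finset.notMem_erase _ _,
                Finset.disjoint_of_subset_left (Finset.erase_subset _ _) hNA⟩) h' hm'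
            simp_rw [Finset.union_insert] at key
            exact key
      · -- the root is a deleted edge: erase it from the ambient network
        by_cases hF1 : F = {s(u, v)}
        · have hN' : N = ∅ := Finset.eq_empty_of_forall_notMem fun f hf => by
            have hfF := hN hf
            rw [hF1, Finset.mem_singleton] at hfF
            exact huvN (hfF ▸ hf)
          rw [hN']
          exact (andGen_sum_empty q A C _ h).le
        · exact ih ((Finset.card_erase_le).trans hF) (hFT.erase_terminal_edge huvF hF1) (Finset.notMem_erase _ _)
            (fun f hf => Finset.mem_erase.2 ⟨fun hh => huvN (hh ▸ hf), hN hf⟩)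
            (fun f hf => Finset.mem_erase.2 ⟨fun hh => huvA (hh ▸ hf), hA hf⟩) hCA hNA h hm
    -- the step: decompose `E` at its root
    intro E s t N A C hcard hE hst hN hA hCA hNA h hmono
    cases hE with
    | edge hst' => exact absurd (Finset.mem_singleton_self _) hst
    | @series E₁ E₂ _ m _ h₁ h₂ hd hV hs' ht' =>
      have hNeq : N = N ∩ E₁ ∪ N ∩ E₂ := by rw [← Finset.inter_union_distrib_left, Finset.inter_eq_left.2 hN]
      have hAeq : A = A ∩ E₁ ∪ A ∩ E₂ := by rw [← Finset.inter_union_distrib_left, Finset.inter_eq_left.2 hA]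
      have hCeq : C = C ∩ E₁ ∪ C ∩ E₂ := by rw [← Finset.inter_union_distrib_left, Finset.inter_eq_left.2 (hCA.trans hA)]
      rw [hNeq] at hmono
      rw [hNeq, hAeq, hCeq]
      -- vertex sets and sizes
      set V₁ : Set V := {z | ∃ e ∈ E₁, z ∈ e} with hV₁
      set V₂ : Set V := {z | ∃ e ∈ E₂, z ∈ e} with hV₂
      have g₁ : ∀ e ∈ (↑E₁ : Set (Sym2 V)), ∀ z ∈ e, z ∈ V₁ := fun e he z hz => ⟨e, he, hz⟩
      have g₂ : ∀ e ∈ (↑E₂ : Set (Sym2 V)), ∀ z ∈ e, z ∈ V₂ := fun e he z hz => ⟨e, he, hz⟩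
      have gS : V₁ ∩ V₂ ⊆ ({m} : Set V) := fun z hz => hV z hz.1 hz.2
      have hsV₂ : s ∉ V₂ := fun ⟨e, he, hse⟩ => hs' e he hse
      have htV₁ : t ∉ V₁ := fun ⟨e, he, hte⟩ => ht' e he hte
      have hsm : s ≠ m := h₁.ne
      have htm : t ≠ m := h₂.ne.symm
      have hstne : s ≠ t := by
        obtain ⟨e, he, hte⟩ := h₂.right_mem
        intro hh; exact hs' e he (hh ▸ hte)
      have hc := Finset.card_union_of_disjoint hd
      have hcard₁ : E₁.card ≤ n := by
        obtain ⟨e, he, _⟩ := h₂.left_mem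
        have h2pos : 0 < E₂.card := Finset.card_pos.2 ⟨e, he⟩
        omega
      have hcard₂ : E₂.card ≤ n := by
        obtain ⟨e, he, _⟩ := h₁.left_mem
        have h1pos : 0 < E₁.card := Finset.card_pos.2 ⟨e, he⟩
        omega
      have hd₁ : Disjoint (N ∩ E₁) (A ∩ E₁) :=
        Finset.disjoint_of_subset_left Finset.inter_subset_left (Finset.disjoint_of_subset_right Finset.inter_subset_left hNA)
      have hd₂ : Disjoint (N ∩ E₂) (A ∩ E₂) :=
        Finset.disjoint_of_subset_left Finset.inter_subset_left (Finset.disjoint_of_subset_right Finset.inter_subset_left hNA)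
      have hCA₁ : C ∩ E₁ ⊆ A ∩ E₁ := Finset.inter_subset_inter hCA le_rfl
      have hCA₂ : C ∩ E₂ ⊆ A ∩ E₂ := Finset.inter_subset_inter hCA le_rfl
      exact andGen_series_nonpos hq0 g₁ g₂ gS hsV₂ htV₁ hsm htm hstne
        (Finset.disjoint_of_subset_left Finset.inter_subset_right (Finset.disjoint_of_subset_right Finset.inter_subset_right hd))
        Finset.inter_subset_right Finset.inter_subset_right Finset.inter_subset_right
        Finset.inter_subset_right Finset.inter_subset_right Finset.inter_subset_right
        (fun h' hm' => virt hcard₁ h₁ Finset.inter_subset_right Finset.inter_subset_right hCA₁ hd₁ h' hm')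
        (fun h' hm' => rootless hcard₁ h₁ Finset.inter_subset_right (Finset.inter_subset_right.trans (Finset.subset_insert _ _))
          hCA₁ hd₁ h' hm')
        (fun h' hm' => virt hcard₂ h₂ Finset.inter_subset_right Finset.inter_subset_right hCA₂ hd₂ h' hm')
        (fun h' hm' => rootless hcard₂ h₂ Finset.inter_subset_right (Finset.inter_subset_right.trans (Finset.subset_insert _ _))
          hCA₂ hd₂ h' hm') hmono
    | @parallel E₁ E₂ _ _ h₁ h₂ hd hV =>
      have hNeq : N = N ∩ E₁ ∪ N ∩ E₂ := by rw [← Finset.inter_union_distrib_left, Finset.inter_eq_left.2 hN]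
      have hAeq : A = A ∩ E₁ ∪ A ∩ E₂ := by rw [← Finset.inter_union_distrib_left, Finset.inter_eq_left.2 hA]
      have hCeq : C = C ∩ E₁ ∪ C ∩ E₂ := by rw [← Finset.inter_union_distrib_left, Finset.inter_eq_left.2 (hCA.trans hA)]
      rw [hNeq] at hmono
      rw [hNeq, hAeq, hCeq]
      set V₁ : Set V := {z | ∃ e ∈ E₁, z ∈ e} with hV₁
      set V₂ : Set V := {z | ∃ e ∈ E₂, z ∈ e} with hV₂
      have g₁ : ∀ e ∈ (↑E₁ : Set (Sym2 V)), ∀ z ∈ e, z ∈ V₁ := fun e he z hz => ⟨e, he, hz⟩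
      have g₂ : ∀ e ∈ (↑E₂ : Set (Sym2 V)), ∀ z ∈ e, z ∈ V₂ := fun e he z hz => ⟨e, he, hz⟩
      have gS : V₁ ∩ V₂ ⊆ ({s, t} : Set V) := by
        intro z hz
        rcases hV z hz.1 hz.2 with h' | h'
        · exact Or.inl h'
        · exact Or.inr h'
      have hstne : s ≠ t := h₁.ne
      have hst₁ : s(s, t) ∉ E₁ := fun h' => hst (Finset.mem_union_left _ h')
      have hst₂ : s(s, t) ∉ E₂ := fun h' => hst (Finset.mem_union_right _ h')
      have hc := Finset.card_union_of_disjoint hd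
      have hcard₁ : E₁.card ≤ n := by
        obtain ⟨e, he, _⟩ := h₂.left_mem
        have h2pos : 0 < E₂.card := Finset.card_pos.2 ⟨e, he⟩
        omega
      have hcard₂ : E₂.card ≤ n := by
        obtain ⟨e, he, _⟩ := h₁.left_mem
        have h1pos : 0 < E₁.card := Finset.card_pos.2 ⟨e, he⟩
        omega
      have hd₁ : Disjoint (N ∩ E₁) (A ∩ E₁) :=
        Finset.disjoint_of_subset_left Finset.inter_subset_left (Finset.disjoint_of_subset_right Finset.inter_subset_left hNA)
      have hd₂ : Disjoint (N ∩ E₂) (A ∩ E₂) :=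
        Finset.disjoint_of_subset_left Finset.inter_subset_left (Finset.disjoint_of_subset_right Finset.inter_subset_left hNA)
      have hCA₁ : C ∩ E₁ ⊆ A ∩ E₁ := Finset.inter_subset_inter hCA le_rfl
      have hCA₂ : C ∩ E₂ ⊆ A ∩ E₂ := Finset.inter_subset_inter hCA le_rfl
      refine andGen_parallel_nonpos hq0 g₁ g₂ gS hstne
        (Finset.disjoint_of_subset_left Finset.inter_subset_right (Finset.disjoint_of_subset_right Finset.inter_subset_right hd))
        Finset.inter_subset_right Finset.inter_subset_right Finset.inter_subset_right
        Finset.inter_subset_right Finset.inter_subset_right Finset.inter_subset_right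
        (fun h' hm' => ih hcard₁ h₁ hst₁ Finset.inter_subset_right Finset.inter_subset_right hCA₁ hd₁ h' hm') ?_
        (fun h' hm' => ih hcard₂ h₂ hst₂ Finset.inter_subset_right Finset.inter_subset_right hCA₂ hd₂ h' hm') ?_ hmono
      · intro h' hm'
        have key := rootless hcard₁ h₁ Finset.inter_subset_right (A := insert s(s, t) (A ∩ E₁)) (C := insert s(s, t) (C ∩ E₁))
          (Finset.insert_subset_insert _ Finset.inter_subset_right) (Finset.insert_subset_insert _ hCA₁)
          (Finset.disjoint_insert_right.2 ⟨fun hh => hst₁ (Finset.inter_subset_right hh), hd₁⟩) h' hm'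
        simp_rw [Finset.union_insert] at key
        exact key
      · intro h' hm'
        have key := rootless hcard₂ h₂ Finset.inter_subset_right (A := insert s(s, t) (A ∩ E₂)) (C := insert s(s, t) (C ∩ E₂))
          (Finset.insert_subset_insert _ Finset.inter_subset_right) (Finset.insert_subset_insert _ hCA₂)
          (Finset.disjoint_insert_right.2 ⟨fun hh => hst₂ (Finset.inter_subset_right hh), hd₂⟩) h' hm'
        simp_rw [Finset.union_insert] at key
        exact key

omit [Fintype V] in
/-- The AND configuration with attached and contracted sets: `γ ∪ (T ∪ {st}) ∪ C = (γ ∪ (T ∪ C)) ∪ {st}`. [folklore] -/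
theorem union_insert_union_eq (γ T C : Finset (Sym2 V)) (e : Sym2 V) :
    γ ∪ insert e T ∪ C = insert e (γ ∪ (T ∪ C)) := by
  ext f
  simp only [Finset.mem_union, Finset.mem_insert]
  tauto

/-- **THEOREM (Conjecture `C_∞` for the AND type — every coefficient, every edge set, every 2-connected series–parallel graph).**
Let `E` be a two-terminal series–parallel network between `s` and `t` with `st ∉ E` (`H = E ∪ {st}` an arbitrary 2-connected series–parallel
graph, presented from an arbitrary edge), and `N, T, C ⊆ E` pairwise disjoint (free, AND, contracted edges; the other edges of `E` are deleted),
`S = T ∪ {st}`.  Then for every `0 < q ≤ 1` and every increasing `g` not reading `S`: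
`apPsiC q (N ∪ S) C 1_{S ⊆ ·} g = ∑_{γ ⊆ N ∪ S} q^{k(γ∪C)+k((N∪S)\γ∪C)} (1_{S⊆γ∪C} - 1_{S⊆((N∪S)\γ)∪C})(g(γ∪C) - g(((N∪S)\γ)∪C)) ≤ 0` —
the coefficient of `z^{1_{N∪S} + 2·1_C}` in `Z_H(z)² · Cov_{φ_{z,q}}(∏_{e ∈ S} ω_e, g)` is `≤ 0`.  Hence `Cov_{φ_{p,q}}(∏_{e∈S} ω_e, g) ≤ 0`
COEFFICIENTWISE for all AND events and increasing `g` on series–parallel graphs, `q ≤ 1`.  Proof: contracted bridge (`apPsiC_andInd_eq`) +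
`andGen_drift_nonpos_of_isTTSP` with `A = T ∪ C`. [cite: Grimmett2006, §3.8 Thm. (3.90) (pp. 61–62); §3.9 (pp. 63–64)] [cite: Wagner2006, Thm. 5.8(d), §5.3] -/
theorem apPsiC_and_nonpos_of_isTTSP {q : ℝ} (hq0 : 0 < q) (hq1 : q ≤ 1) {E : Finset (Sym2 V)} {s t : V}
    (hE : IsTTSP E s t) (hst : s(s, t) ∉ E) {N T C : Finset (Sym2 V)} (hN : N ⊆ E) (hT : T ⊆ E) (hC : C ⊆ E)
    (hNT : Disjoint N T) (hNC : Disjoint N C) (hTC : Disjoint T C)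
    {g : Finset (Sym2 V) → ℝ} (hg : ∀ A U : Finset (Sym2 V), U ⊆ insert s(s, t) T → g (A ∪ U) = g A)
    (hmono : ∀ ⦃X Y : Finset (Sym2 V)⦄, X ⊆ Y → g X ≤ g Y) :
    apPsiC q (N ∪ insert s(s, t) T) C (fun X => if insert s(s, t) T ⊆ X then 1 else 0) g ≤ 0 := by
  have hNS : Disjoint N (insert s(s, t) T) := Finset.disjoint_insert_right.2 ⟨fun h => hst (hN h), hNT⟩
  have hSC : Disjoint (insert s(s, t) T) C := Finset.disjoint_insert_left.2 ⟨fun h => hst (hC h), hTC⟩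
  rw [apPsiC_andInd_eq q hNS ⟨s(s, t), Finset.mem_insert_self _ _⟩ hSC hg]
  have main := andGen_drift_nonpos_of_isTTSP hq0 hq1 E.card le_rfl hE hst hN (A := T ∪ C) (C := C) (Finset.union_subset hT hC)
    Finset.subset_union_right (Finset.disjoint_union_right.2 ⟨hNT, hNC⟩) (fun γ => g (γ ∪ C))
    (fun X Y hXY _ => hmono (Finset.union_subset_union hXY le_rfl))
  have hsum : ∑ γ ∈ N.powerset, (q ^ (clusterCount (↑(γ ∪ insert s(s, t) T ∪ C) : BondConfig V) ∅ + clusterCount (↑(N \ γ ∪ C) : BondConfig V) ∅) -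
        q ^ (clusterCount (↑(N \ γ ∪ insert s(s, t) T ∪ C) : BondConfig V) ∅ + clusterCount (↑(γ ∪ C) : BondConfig V) ∅)) * g (γ ∪ C) =
      ∑ γ ∈ N.powerset, (q ^ (clusterCount (↑(insert s(s, t) (γ ∪ (T ∪ C))) : BondConfig V) ∅ + clusterCount (↑(N \ γ ∪ C) : BondConfig V) ∅) -
        q ^ (clusterCount (↑(insert s(s, t) (N \ γ ∪ (T ∪ C))) : BondConfig V) ∅ + clusterCount (↑(γ ∪ C) : BondConfig V) ∅)) * g (γ ∪ C) := by
    refine Finset.sum_congr rfl fun γ _ => ?_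
    rw [union_insert_union_eq, union_insert_union_eq]
  rw [hsum]
  linarith

/-- **THEOREM (Conjecture `C_∞` for the AND type, square-free form).**  `E` TTSP between `s, t`, `st ∉ E`, `N, T ⊆ E` disjoint, `S = T ∪ {st}`:
for every `0 < q ≤ 1` and every `g` increasing on the subsets of `N` and not reading `S`,
`apPsi q (N ∪ S) 1_{S ⊆ ·} g = ∑_{γ ⊆ N∪S} q^{k(γ)+k((N∪S)\γ)} (1_S(γ) - 1_S((N∪S)\γ)) (g(γ) - g((N∪S)\γ)) ≤ 0` — every square-free
coefficient of `Z_H(z)² Cov_{φ_{z,q}}(∏_{e∈S} ω_e, g)` is `≤ 0`, for EVERY edge set `S` of EVERY 2-connected series–parallel graph `H`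
(gen 10's Conjecture `C_∞`, AND type; `|S| = 1` is gen 11's Theorem U in `apPsi` form, `|S| = 3` files 30a/31b).
[cite: Grimmett2006, §3.8 Thm. (3.90) (pp. 61–62); §3.9 (pp. 63–64)] [cite: Wagner2006, Thm. 5.8(d), §5.3] -/
theorem apPsi_and_nonpos_of_isTTSP {q : ℝ} (hq0 : 0 < q) (hq1 : q ≤ 1) {E : Finset (Sym2 V)} {s t : V}
    (hE : IsTTSP E s t) (hst : s(s, t) ∉ E) {N T : Finset (Sym2 V)} (hN : N ⊆ E) (hT : T ⊆ E) (hNT : Disjoint N T)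
    {g : Finset (Sym2 V) → ℝ} (hg : ∀ A U : Finset (Sym2 V), U ⊆ insert s(s, t) T → g (A ∪ U) = g A)
    (hmono : ∀ ⦃X Y : Finset (Sym2 V)⦄, X ⊆ Y → Y ⊆ N → g X ≤ g Y) :
    apPsi q (N ∪ insert s(s, t) T) (fun X => if insert s(s, t) T ⊆ X then 1 else 0) g ≤ 0 := by
  have hNS : Disjoint N (insert s(s, t) T) := Finset.disjoint_insert_right.2 ⟨fun h => hst (hN h), hNT⟩
  rw [apPsi_andInd_eq q hNS ⟨s(s, t), Finset.mem_insert_self _ _⟩ hg]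
  have main := andGen_drift_nonpos_of_isTTSP hq0 hq1 E.card le_rfl hE hst hN (A := T) (C := ∅) hT (Finset.empty_subset _) hNT g hmono
  have hsum : ∑ γ ∈ N.powerset, (q ^ (clusterCount (↑(γ ∪ insert s(s, t) T) : BondConfig V) ∅ + clusterCount (↑(N \ γ) : BondConfig V) ∅) -
        q ^ (clusterCount (↑(N \ γ ∪ insert s(s, t) T) : BondConfig V) ∅ + clusterCount (↑γ : BondConfig V) ∅)) * g γ =
      ∑ γ ∈ N.powerset, (q ^ (clusterCount (↑(insert s(s, t) (γ ∪ T)) : BondConfig V) ∅ + clusterCount (↑(N \ γ ∪ ∅) : BondConfig V) ∅) -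
        q ^ (clusterCount (↑(insert s(s, t) (N \ γ ∪ T)) : BondConfig V) ∅ + clusterCount (↑(γ ∪ ∅) : BondConfig V) ∅)) * g γ := by
    refine Finset.sum_congr rfl fun γ _ => ?_
    rw [Finset.union_insert, Finset.union_insert, Finset.union_empty, Finset.union_empty]
  rw [hsum]
  linarith

end GenPath

end FK

end Summit.CriticalPhenomena.PercolationContinuityZ3.Theorems

end
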